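import Mathlib

/-!
# Route PhotonSphereChannels · crux `TameCensorship` (stmt-FinalStateConjecture-17431) · line `Sketch`, skeleton v5 ·
# stub `stub_forcedSpeed`: forced speed of a curve with quadratically bounded acceleration

Helper file (`--supports stmt-FinalStateConjecture-17431`) of line `Sketch` (lead c2, 2026-08-17), brick P1 of the
PANCAKE LAW (the lever of the sibling crux-plan line `tame-outer-censors`, absorbed into skeleton v5 as the alternative
route to clause (a) of K3): in a tame chart of clause (ii) the chart curve `x = Ψ⁻¹ ∘ γ` of a null geodesic solves
`x'' = −Γ(x)(x', x')` with `|Γ| ≤ K(Λ, r₀)`, hence `‖x''‖ ≤ K ‖x'‖²`; if the geodesic must leave the half-ball of the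
chart (displacement `d = r₀/2`) within its remaining affine length `s − t₀ < ε`, its chart speed at `t₀` is at least
`(1 − e^{−K d}) / (K ε)` — the FORCED BOOST. This file is the pure real-analysis comparison lemma, stated for a
curve in an arbitrary real normed space (no Lorentzian vocabulary).

References: P. Hartman, *Ordinary Differential Equations* (1964), Ch. III (comparison theorems); B. O'Neill,
*Semi-Riemannian Geometry* (1983), Ch. 3, Prop. 3.21 ff. (geodesic equations in a chart).
-/

set_option linter.dupNamespace false

open Set Filter Real Topology

noncomputable section

namespace Summit.FinalStateConjecture.FinalStateConjecture.Theorems.PhotonSphereChannels.TameCensorshipUnwind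

/-- Riccati comparison with room: if `x' = v`, `v' = a` on `[t₀, s]` with `‖a‖ ≤ K ‖v‖²`, and `κ > K`, `κ > 0`,
`u > ‖v t₀‖` with `κ u (s − t₀) < 1`, then the speed is dominated by the Riccati majorant
`u / (1 − κ u (τ − t₀))` (strict fencing lemma) and hence the displacement by its primitive:
`‖x s − x t₀‖ ≤ −κ⁻¹ log (1 − κ u (s − t₀))` (non-strict fencing lemma). -/
private theorem norm_sub_le_riccati_primitive {E : Type*} [NormedAddCommGroup E] [NormedSpace ℝ E]
    {x v a : ℝ → E} {K t₀ s κ u : ℝ}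
    (hx : ∀ t ∈ Icc t₀ s, HasDerivAt x (v t) t) (hv : ∀ t ∈ Icc t₀ s, HasDerivAt v (a t) t)
    (ha : ∀ t ∈ Icc t₀ s, ‖a t‖ ≤ K * ‖v t‖ ^ 2) (hts : t₀ ≤ s)
    (hκ₀ : 0 < κ) (hκ : K < κ) (hu : ‖v t₀‖ < u) (h1 : κ * u * (s - t₀) < 1) :
    ‖x s - x t₀‖ ≤ -(1 / κ) * Real.log (1 - κ * u * (s - t₀)) := by
  have hu₀ : 0 < u := (norm_nonneg _).trans_lt hu
  have hκne : κ ≠ 0 := hκ₀.ne'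
  -- the denominator of the Riccati majorant is positive on `[t₀, s]`
  have hD : ∀ τ ∈ Icc t₀ s, 0 < 1 - κ * u * (τ - t₀) := fun τ hτ => by
    have : κ * u * (τ - t₀) ≤ κ * u * (s - t₀) :=
      mul_le_mul_of_nonneg_left (sub_le_sub_right hτ.2 _) (mul_pos hκ₀ hu₀).le
    linarith
  -- derivative of the denominator
  have hDd : ∀ τ, HasDerivAt (fun y => 1 - κ * u * (y - t₀)) (-(κ * u)) τ := fun τ => by
    simpa using (((hasDerivAt_id' τ).sub_const t₀).const_mul (κ * u)).const_sub 1
  -- the Riccati majorant `B τ = u / (1 - κ u (τ - t₀))` solves `B' = κ B²`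
  have hBd : ∀ τ ∈ Icc t₀ s, HasDerivAt (fun y => u / (1 - κ * u * (y - t₀)))
      (κ * (u / (1 - κ * u * (τ - t₀))) ^ 2) τ := fun τ hτ => by
    have hDne : 1 - κ * u * (τ - t₀) ≠ 0 := (hD τ hτ).ne'
    refine ((hasDerivAt_const τ u).fun_div (hDd τ) hDne).congr_deriv ?_
    rw [div_pow]
    field_simp
    ring
  -- its primitive `P τ = -κ⁻¹ log (1 - κ u (τ - t₀))` solves `P' = B`
  have hPd : ∀ τ ∈ Icc t₀ s, HasDerivAt (fun y => -(1 / κ) * Real.log (1 - κ * u * (y - t₀)))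
      (u / (1 - κ * u * (τ - t₀))) τ := fun τ hτ => by
    have hDne : 1 - κ * u * (τ - t₀) ≠ 0 := (hD τ hτ).ne'
    refine (((hDd τ).log hDne).const_mul (-(1 / κ))).congr_deriv ?_
    field_simp
  -- continuity of `v` and of the displacement
  have hvc : ContinuousOn v (Icc t₀ s) := fun t ht => (hv t ht).continuousAt.continuousWithinAt
  have hxc : ContinuousOn (fun y => x y - x t₀) (Icc t₀ s) := fun t ht =>
    ((hx t ht).continuousAt.sub continuousAt_const).continuousWithinAt
  -- Step 1: the speed is dominated by the Riccati majorant (strict fencing lemma)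
  have step1 : ∀ ⦃τ⦄, τ ∈ Icc t₀ s → ‖v τ‖ ≤ u / (1 - κ * u * (τ - t₀)) := by
    refine image_norm_le_of_norm_deriv_right_lt_deriv_boundary' (f := v) (f' := a)
      (B := fun τ => u / (1 - κ * u * (τ - t₀)))
      (B' := fun τ => κ * (u / (1 - κ * u * (τ - t₀))) ^ 2) hvc
      (fun τ hτ => (hv τ (Ico_subset_Icc_self hτ)).hasDerivWithinAt) ?_
      (fun τ hτ => (hBd τ hτ).continuousAt.continuousWithinAt)
      (fun τ hτ => (hBd τ (Ico_subset_Icc_self hτ)).hasDerivWithinAt) ?_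
    · simpa using hu.le
    · intro τ hτ heq
      have hB₀ : 0 < u / (1 - κ * u * (τ - t₀)) := div_pos hu₀ (hD τ (Ico_subset_Icc_self hτ))
      calc ‖a τ‖ ≤ K * ‖v τ‖ ^ 2 := ha τ (Ico_subset_Icc_self hτ)
        _ = K * (u / (1 - κ * u * (τ - t₀))) ^ 2 := by rw [heq]
        _ < κ * (u / (1 - κ * u * (τ - t₀))) ^ 2 := mul_lt_mul_of_pos_right hκ (pow_pos hB₀ 2)
  -- Step 2: the displacement is dominated by the primitive (non-strict fencing lemma)
  have step2 : ∀ ⦃τ⦄, τ ∈ Icc t₀ s →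
      ‖x τ - x t₀‖ ≤ -(1 / κ) * Real.log (1 - κ * u * (τ - t₀)) := by
    refine image_norm_le_of_norm_deriv_right_le_deriv_boundary' (f := fun y => x y - x t₀) (f' := v)
      (B := fun τ => -(1 / κ) * Real.log (1 - κ * u * (τ - t₀)))
      (B' := fun τ => u / (1 - κ * u * (τ - t₀))) hxc
      (fun τ hτ => ((hx τ (Ico_subset_Icc_self hτ)).sub_const (x t₀)).hasDerivWithinAt) ?_
      (fun τ hτ => (hPd τ hτ).continuousAt.continuousWithinAt)
      (fun τ hτ => (hPd τ (Ico_subset_Icc_self hτ)).hasDerivWithinAt)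
      (fun τ hτ => step1 (Ico_subset_Icc_self hτ))
    simp
  exact step2 (right_mem_Icc.2 hts)

/-- **Stub `stub_forcedSpeed` of line `Sketch` (skeleton v5) for the crux `PhotonSphereChannels.TameCensorship`
(stmt-FinalStateConjecture-17431): FORCED SPEED.** Let `x : ℝ → E` have derivative `v` and second derivative `a`
on `[t₀, s]` with `‖a t‖ ≤ K ‖v t‖²` (`K > 0`), and let `d ≤ ‖x s − x t₀‖`. Then
`(1 − exp (−K d)) / (K (s − t₀)) ≤ ‖v t₀‖`. Proof: if `u₀ := ‖v t₀‖` were smaller, then `K u₀ (s − t₀) < 1`, the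
Riccati majorant `w τ = u / (1 − κ u (τ − t₀))` (`κ = K + ε`, `u = u₀ + ε`) solves `w' = κ w²` on `[t₀, s]` and
dominates `‖v‖` (`image_norm_le_of_norm_deriv_right_lt_deriv_boundary'`), and its primitive
`−κ⁻¹ log (1 − κ u (τ − t₀))` dominates `‖x τ − x t₀‖`; at `τ = s` and for `ε → 0⁺` this is `< d`, a
contradiction. For `d ≤ 0` the claim is trivial. [folklore; Hartman 1964, Ch. III] -/
theorem stub_forcedSpeed :
    ∀ (E : Type) [NormedAddCommGroup E] [NormedSpace ℝ E] (x v a : ℝ → E) (K d t₀ s : ℝ),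
    0 < K → t₀ < s → (∀ t ∈ Set.Icc t₀ s, HasDerivAt x (v t) t) →
    (∀ t ∈ Set.Icc t₀ s, HasDerivAt v (a t) t) → (∀ t ∈ Set.Icc t₀ s, ‖a t‖ ≤ K * ‖v t‖ ^ 2) →
    d ≤ ‖x s - x t₀‖ → (1 - Real.exp (-(K * d))) / (K * (s - t₀)) ≤ ‖v t₀‖ := by
  intro E _ _ x v a K d t₀ s hK hts hx hv ha hd
  by_contra! hlt
  have hKne : K ≠ 0 := hK.ne'
  have hT : 0 < s - t₀ := sub_pos.2 hts
  have hKT : 0 < K * (s - t₀) := mul_pos hK hT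
  have h1 : ‖v t₀‖ * (K * (s - t₀)) < 1 - Real.exp (-(K * d)) := (lt_div_iff₀ hKT).1 hlt
  have hexp : 0 < Real.exp (-(K * d)) := Real.exp_pos _
  have h2 : K * ‖v t₀‖ * (s - t₀) < 1 := by nlinarith
  -- the limiting (`ε = 0`) value of the displacement bound is `< d`
  have hlim : -(1 / K) * Real.log (1 - K * ‖v t₀‖ * (s - t₀)) < d := by
    have hgt : Real.exp (-(K * d)) < 1 - K * ‖v t₀‖ * (s - t₀) := by nlinarith
    have hlog : -(K * d) < Real.log (1 - K * ‖v t₀‖ * (s - t₀)) :=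
      (Real.lt_log_iff_exp_lt (hexp.trans hgt)).2 hgt
    have hneg : -(1 / K) < 0 := neg_lt_zero.2 (one_div_pos.2 hK)
    calc -(1 / K) * Real.log (1 - K * ‖v t₀‖ * (s - t₀)) < -(1 / K) * (-(K * d)) :=
        mul_lt_mul_of_neg_left hlog hneg
      _ = d := by field_simp
  -- choose the room `ε > 0`
  obtain ⟨ε, hε, hε1, hε2⟩ : ∃ ε : ℝ, 0 < ε ∧ (K + ε) * (‖v t₀‖ + ε) * (s - t₀) < 1 ∧
      -(1 / (K + ε)) * Real.log (1 - (K + ε) * (‖v t₀‖ + ε) * (s - t₀)) < d := by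
    have hc1 : ContinuousAt (fun ε : ℝ => (K + ε) * (‖v t₀‖ + ε) * (s - t₀)) 0 := by fun_prop
    have hK0 : K + 0 ≠ 0 := by rwa [add_zero]
    have hD0 : 1 - (K + 0) * (‖v t₀‖ + 0) * (s - t₀) ≠ 0 := by
      rw [add_zero, add_zero]
      exact (sub_pos.2 h2).ne'
    have hc2 : ContinuousAt
        (fun ε : ℝ => -(1 / (K + ε)) * Real.log (1 - (K + ε) * (‖v t₀‖ + ε) * (s - t₀))) 0 := by
      fun_prop (disch := assumption)
    have e1 : ∀ᶠ ε in 𝓝 (0 : ℝ), (K + ε) * (‖v t₀‖ + ε) * (s - t₀) < 1 :=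
      hc1.eventually_lt continuousAt_const (by simpa using h2)
    have e2 : ∀ᶠ ε in 𝓝 (0 : ℝ),
        -(1 / (K + ε)) * Real.log (1 - (K + ε) * (‖v t₀‖ + ε) * (s - t₀)) < d :=
      hc2.eventually_lt continuousAt_const (by simpa using hlim)
    have e3 : ∀ᶠ ε in 𝓝[>] (0 : ℝ), (0 : ℝ) < ε := eventually_mem_nhdsWithin
    obtain ⟨ε, h0, h1', h2'⟩ := (e3.and ((e1.and e2).filter_mono nhdsWithin_le_nhds)).exists
    exact ⟨ε, h0, h1', h2'⟩
  have key := norm_sub_le_riccati_primitive hx hv ha hts.le (by linarith) (lt_add_of_pos_right K hε)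
    (lt_add_of_pos_right _ hε) hε1
  linarith

end Summit.FinalStateConjecture.FinalStateConjecture.Theorems.PhotonSphereChannels.TameCensorshipUnwind

end
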